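import Summits.QuantumFields.YangMills.Theorems.F4SubCurvatureDoorBigOBudgetSharpnessRPDeriv
import Summits.QuantumFields.YangMills.Theorems.F4SubCurvatureDoorBigOBudgetSharpnessRPLaplace
import Summits.QuantumFields.YangMills.Theorems.F4SubCurvatureDoorBigOBudgetSharpnessSymmetry
import Literature.MathematicalPhysics.QuantumLattice.EuclideanAction
import Literature.Algebra.EuclideanLattices.FccBccLattices
import Mathlib
import HarnessLib

/-!
# «BIG-O BUDGET SHARPNESS» for crux ⟨stmt-QuantumFields-23035⟩ `ShortRootRigidity` — REFLECTION POSITIVITY of the witness and the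
# negative target `NotShortRootRigidityBigO` ASSEMBLED

Free-hands work of width seat `ym-line-sfw-p2-w4` (g24, cell `ym-idea-1`), closing the owner's NEGATIVE TARGET
`Cruxes/ShortRootRigidity/BigOBudgetSharpnessTarget.lean` (ym-idea-3 g21, f5448735ed23): the last witness clause `WitnessReflectionPositive`
(Props restated character-for-character, namespace `…Cruxes.ShortRootRigidity.Sharpness` as in w3 g37's `…Witness`/`…Symmetry` files) and the
assembly `not_shortRootRigidityBigO : NotShortRootRigidityBigO` (the owner's `notShortRootRigidityBigO_of_witness` at the seven clauses) — landed FLAT as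
`Theorems/F4SubCurvatureDoorBigOBudgetSharpnessRP.lean` (the gate's `Theorems/<Crux>/Negative/` lane is reserved for `--negative-modulo` lemmas).

THE LAPLACE–FOURIER REPRESENTATION (`bigOWitness_eq_integral`): for `y = (t, z⃗) ∈ ℝ⁴` with `t > 0`,

  `K(y) = 3h₆(y)/‖y‖¹⁴ = (π⁷/5) ∫_{ℝ³} e^{−2πt|w|} |w|⁻¹ e^{−2πi⟪w,z⃗⟫} W(w) dw`,  `W(w) = Σ_{j≠k} w_j⁴w_k² + 2w₁²w₂²w₃² ≥ 0`

(= the owner's `(1/(1280π)) ∫ W(p)e^{−t|p|}cos⟪p,z⃗⟫|p|⁻¹dp` after `p = 2πw`).  Proof: part 1 (`…RPDeriv`: `−46080·K(y) = Σ_{v ∈ 24 roots}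
(d/ds)⁶‖y + sv‖⁻²|₀`, Hobson's formula with `Δ³‖y‖⁻² = 0`) + part 2 (`…RPLaplace`: each `(d/ds)⁶‖y+sv‖⁻²|₀ = π∫ e^{−2πt|w|}|w|⁻¹
e^{−2πi⟪w,z⃗⟫} λ_v(w)⁶ dw`, `λ_v(w) = −2πv₀|w| − 2πi⟪w,v⃗⟫`, from the tree's Yukawa transform) + the NULL-SHELL SYMBOL
`Σ_v λ_v(w)⁶ = −9216π⁶ W(w)` (`sum_T_slope_pow_six`; `ℓ = −2π(|w|, iw⃗)` is a null vector, `3h₆(ℓ) = 15(ℓ·ℓ)³ − Σ_v⟪v,ℓ⟫⁶`, and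
`3h₆(−|w|, iw⃗) = 144·W(w)`).  REFLECTION POSITIVITY (`witnessReflectionPositive`): `θxᵢ − xⱼ = −(tᵢ + tⱼ, z⃗ⱼ − z⃗ᵢ)`, `K` is even, so
`Σᵢⱼ cᵢcⱼ K(θxᵢ − xⱼ) = (π⁷/5) ∫ |w|⁻¹ W(w) |Σⱼ cⱼ e^{−2πtⱼ|w|} e^{−2πi⟪w,z⃗ⱼ⟫}|² dw ≥ 0`.

HONEST LABEL: a SHARPNESS statement about the HYPOTHESES of an OPEN crux (any proof of ⟨23035⟩ must use the little-o budget at exponent 8);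
nothing of ⟨23035⟩, ⟨23125⟩, R2d, my cell's ⟨22884⟩ or the Yang–Mills mass gap is proved by this; `--supports stmt-QuantumFields-23035`.
-/

set_option autoImplicit false

noncomputable section

namespace Summit.QuantumFields.YangMills.Cruxes.ShortRootRigidity.Sharpness

open MeasureTheory Set Filter Metric Complex
open scoped Topology RealInnerProductSpace BigOperators ComplexConjugate
open Literature.MathematicalPhysics.QuantumLattice (timeReflection timeReflection_apply siteToE)
open Summit.QuantumFields.YangMills.Cruxes.OSLegsAtWeakCouplingC.Sketch (IsSignedPerm)

/-! ## The registered texts (verbatim from the target file) -/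

/-- Witness clause: reflection positivity across `x₀ = 0` (verbatim). [problem-side target] -/
def WitnessReflectionPositive : Prop :=
  ∀ (m : ℕ) (x : Fin m → E4) (c : Fin m → ℝ), (∀ i, 0 < x i 0) →
    0 ≤ ∑ i, ∑ j, c i * c j * bigOWitness (timeReflection 4 (x i) - x j)

/-- C3 «GLOBAL SHORT-ROOT RIGIDITY» with the BIG-O budget `‖x‖⁸|K x| ≤ C` in place of the little-o budget (verbatim). [problem-side definition] -/
def ShortRootRigidityBigO : Prop :=
  ∀ K : E4 → ℝ,
    ContinuousOn K {x | x ≠ 0} →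
    (∃ C : ℝ, ∀ x, 1 ≤ ‖x‖ → |K x| ≤ C) →
    (∀ R : E4 ≃ₗᵢ[ℝ] E4, IsSignedPerm R → ∀ x, K (R x) = K x) →
    (∀ (m : ℕ) (x : Fin m → E4) (c : Fin m → ℝ), (∀ i, 0 < x i 0) →
        0 ≤ ∑ i, ∑ j, c i * c j * K (timeReflection 4 (x i) - x j)) →
    (∃ C : ℝ, ∀ x, x ≠ 0 → ‖x‖ ^ 8 * |K x| ≤ C) →
    (∀ R : E4 ≃ₗᵢ[ℝ] E4,
        (∀ z : Fin 4 → ℤ, Even (∑ i, z i) → ∃ w : Fin 4 → ℤ, Even (∑ i, w i) ∧ R (siteToE z) = siteToE w) →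
        ∀ x, K (R x) = K x) →
    ∀ (R : E4 ≃ₗᵢ[ℝ] E4) (x : E4), K (R x) = K x

/-- **NEGATIVE TARGET (by name)**: the big-O version of C3 is false (verbatim). [problem-side target] -/
def NotShortRootRigidityBigO : Prop := ¬ ShortRootRigidityBigO

/-! ## §1 Time/space splitting of `ℝ⁴` and sums over the 24 roots -/

/-- `‖y + sv‖² = (y₀ + sv₀)² + ‖y⃗ + s v⃗‖²` (spatial part as a vector of `ℝ³`). [folklore] -/
theorem norm_add_smul_sq_split (y v : E4) (s : ℝ) :
    ‖y + s • v‖ ^ 2 = (y 0 + s * v 0) ^ 2 +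
      ‖(WithLp.equiv 2 (Fin 3 → ℝ)).symm (fun j : Fin 3 => y j.succ) +
        s • (WithLp.equiv 2 (Fin 3 → ℝ)).symm (fun j : Fin 3 => v j.succ)‖ ^ 2 := by
  rw [norm_sq_E4, EuclideanSpace.real_norm_sq_eq, Fin.sum_univ_three]
  simp only [PiLp.add_apply, PiLp.smul_apply, smul_eq_mul, WithLp.equiv_symm_apply, Fin.isValue, Fin.succ_zero_eq_one,
    Fin.succ_one_eq_two]
  rw [show (2 : Fin 3).succ = (3 : Fin 4) from rfl]
  ring

/-- `⟪w, v⃗⟫` in coordinates. [folklore] -/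
theorem inner_spacePart (w : EuclideanSpace ℝ (Fin 3)) (v : E4) :
    ⟪w, (WithLp.equiv 2 (Fin 3 → ℝ)).symm (fun j : Fin 3 => v j.succ)⟫ = w 0 * v 1 + w 1 * v 2 + w 2 * v 3 := by
  rw [PiLp.inner_apply, Fin.sum_univ_three]
  simp only [WithLp.equiv_symm_apply, PiLp.toLp_apply, Fin.isValue, Fin.succ_zero_eq_one, Fin.succ_one_eq_two,
    RCLike.inner_apply, conj_trivial]
  rw [show (2 : Fin 3).succ = (3 : Fin 4) from rfl]
  ring

/-- The nested sum over `i < j` and four signs is the sum over w3's index set `T` of the 24 minimal vectors. [folklore] -/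
theorem sum_roots_eq_sum_T {M : Type*} [AddCommMonoid M] (f : E4 → M) :
    (∑ i : Fin 4, ∑ j : Fin 4, if i < j then
      f (rootVec i j true true) + f (rootVec i j true false) + f (rootVec i j false true) + f (rootVec i j false false)
      else 0) = ∑ t ∈ T, f (rv t) := by
  rw [T, Finset.sum_filter, Fintype.sum_prod_type]
  refine Finset.sum_congr rfl fun i _ => ?_
  rw [Fintype.sum_prod_type]
  refine Finset.sum_congr rfl fun j _ => ?_
  rw [Fintype.sum_prod_type, Fintype.sum_bool, Fintype.sum_bool, Fintype.sum_bool]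
  simp only [rv]
  split_ifs
  · simp only [add_assoc]
  · simp

/-! ## §2 The null-shell symbol: `Σ_v λ_v(w)⁶ = −9216 π⁶ W(w)` -/

/-- **The null-shell symbol.**  With `λ_v(w) = −2πv₀|w| − 2πi⟪w,v⃗⟫` for the 24 roots `v`:
`Σ_v λ_v(w)⁶ = −9216π⁶ (Σ_{j≠k} w_j⁴w_k² + 2w₀²w₁²w₂²)` (`= −(2π)⁶·3h₆(−|w|, iw⃗)`; the vector `(−2π|w|, −2πiw⃗)` is null). [folklore] -/
theorem sum_T_slope_pow_six (w : EuclideanSpace ℝ (Fin 3)) :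
    ∑ t ∈ T, ((((-(2 * Real.pi * (rv t) 0 * ‖w‖)) : ℝ) : ℂ) +
        (((-(2 * Real.pi * ⟪w, (WithLp.equiv 2 (Fin 3 → ℝ)).symm (fun j : Fin 3 => (rv t) j.succ)⟫)) : ℝ) : ℂ) * I) ^ 6 =
      (((-9216 * Real.pi ^ 6 * (w 0 ^ 4 * w 1 ^ 2 + w 0 ^ 4 * w 2 ^ 2 + w 1 ^ 4 * w 0 ^ 2 + w 1 ^ 4 * w 2 ^ 2 +
        w 2 ^ 4 * w 0 ^ 2 + w 2 ^ 4 * w 1 ^ 2 + 2 * (w 0 ^ 2 * w 1 ^ 2 * w 2 ^ 2))) : ℝ) : ℂ) := by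
  rw [← sum_roots_eq_sum_T (fun v : E4 => ((((-(2 * Real.pi * v 0 * ‖w‖)) : ℝ) : ℂ) +
    (((-(2 * Real.pi * ⟪w, (WithLp.equiv 2 (Fin 3 → ℝ)).symm (fun j : Fin 3 => v j.succ)⟫)) : ℝ) : ℂ) * I) ^ 6)]
  simp only [inner_spacePart]
  simp only [rootVec_apply, Fin.sum_univ_four, Fin.isValue, Fin.reduceLT, if_true, if_false, Bool.false_eq_true,
    Fin.reduceEq]
  have hn : ((‖w‖ : ℝ) : ℂ) ^ 2 = ((w 0 : ℝ) : ℂ) ^ 2 + ((w 1 : ℝ) : ℂ) ^ 2 + ((w 2 : ℝ) : ℂ) ^ 2 := by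
    rw [← Complex.ofReal_pow, Literature.Algebra.EuclideanLattices.norm_sq_fin_three]; push_cast; ring
  push_cast
  linear_combination (768 * (Real.pi : ℂ) ^ 6 * ((w 2 : ℝ) : ℂ) ^ 6 + 3840 * (Real.pi : ℂ) ^ 6 * ((w 1 : ℝ) : ℂ) ^ 2 * ((w 2 : ℝ) : ℂ) ^ 4 +
      3840 * (Real.pi : ℂ) ^ 6 * ((w 1 : ℝ) : ℂ) ^ 4 * ((w 2 : ℝ) : ℂ) ^ 2 + 768 * (Real.pi : ℂ) ^ 6 * ((w 1 : ℝ) : ℂ) ^ 6 +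
      3840 * (Real.pi : ℂ) ^ 6 * ((w 0 : ℝ) : ℂ) ^ 2 * ((w 2 : ℝ) : ℂ) ^ 4 + 3840 * (Real.pi : ℂ) ^ 6 * ((w 0 : ℝ) : ℂ) ^ 2 *
      ((w 1 : ℝ) : ℂ) ^ 4 + 3840 * (Real.pi : ℂ) ^ 6 * ((w 0 : ℝ) : ℂ) ^ 4 * ((w 2 : ℝ) : ℂ) ^ 2 + 3840 * (Real.pi : ℂ) ^ 6 *
      ((w 0 : ℝ) : ℂ) ^ 4 * ((w 1 : ℝ) : ℂ) ^ 2 + 768 * (Real.pi : ℂ) ^ 6 * ((w 0 : ℝ) : ℂ) ^ 6 - 3840 * (Real.pi : ℂ) ^ 6 *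
      (‖w‖ : ℂ) ^ 2 * ((w 2 : ℝ) : ℂ) ^ 4 - 3840 * (Real.pi : ℂ) ^ 6 * (‖w‖ : ℂ) ^ 2 * ((w 1 : ℝ) : ℂ) ^ 4 - 3840 * (Real.pi :
      ℂ) ^ 6 * (‖w‖ : ℂ) ^ 2 * ((w 0 : ℝ) : ℂ) ^ 4 + 3840 * (Real.pi : ℂ) ^ 6 * (‖w‖ : ℂ) ^ 4 * ((w 2 : ℝ) : ℂ) ^ 2 + 3840 *
      (Real.pi : ℂ) ^ 6 * (‖w‖ : ℂ) ^ 4 * ((w 1 : ℝ) : ℂ) ^ 2 + 3840 * (Real.pi : ℂ) ^ 6 * (‖w‖ : ℂ) ^ 4 * ((w 0 : ℝ) : ℂ) ^ 2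
      - 768 * (Real.pi : ℂ) ^ 6 * I ^ 2 * ((w 2 : ℝ) : ℂ) ^ 6 - 3840 * (Real.pi : ℂ) ^ 6 * I ^ 2 * ((w 1 : ℝ) : ℂ) ^ 2 * ((w 2
      : ℝ) : ℂ) ^ 4 - 3840 * (Real.pi : ℂ) ^ 6 * I ^ 2 * ((w 1 : ℝ) : ℂ) ^ 4 * ((w 2 : ℝ) : ℂ) ^ 2 - 768 * (Real.pi : ℂ) ^ 6 *
      I ^ 2 * ((w 1 : ℝ) : ℂ) ^ 6 - 3840 * (Real.pi : ℂ) ^ 6 * I ^ 2 * ((w 0 : ℝ) : ℂ) ^ 2 * ((w 2 : ℝ) : ℂ) ^ 4 - 3840 *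
      (Real.pi : ℂ) ^ 6 * I ^ 2 * ((w 0 : ℝ) : ℂ) ^ 2 * ((w 1 : ℝ) : ℂ) ^ 4 - 3840 * (Real.pi : ℂ) ^ 6 * I ^ 2 * ((w 0 : ℝ) :
      ℂ) ^ 4 * ((w 2 : ℝ) : ℂ) ^ 2 - 3840 * (Real.pi : ℂ) ^ 6 * I ^ 2 * ((w 0 : ℝ) : ℂ) ^ 4 * ((w 1 : ℝ) : ℂ) ^ 2 - 768 *
      (Real.pi : ℂ) ^ 6 * I ^ 2 * ((w 0 : ℝ) : ℂ) ^ 6 + 3840 * (Real.pi : ℂ) ^ 6 * I ^ 2 * (‖w‖ : ℂ) ^ 2 * ((w 2 : ℝ) : ℂ) ^ 4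
      + 3840 * (Real.pi : ℂ) ^ 6 * I ^ 2 * (‖w‖ : ℂ) ^ 2 * ((w 1 : ℝ) : ℂ) ^ 4 + 3840 * (Real.pi : ℂ) ^ 6 * I ^ 2 * (‖w‖ : ℂ)
      ^ 2 * ((w 0 : ℝ) : ℂ) ^ 4 + 768 * (Real.pi : ℂ) ^ 6 * I ^ 4 * ((w 2 : ℝ) : ℂ) ^ 6 + 3840 * (Real.pi : ℂ) ^ 6 * I ^ 4 *
      ((w 1 : ℝ) : ℂ) ^ 2 * ((w 2 : ℝ) : ℂ) ^ 4 + 3840 * (Real.pi : ℂ) ^ 6 * I ^ 4 * ((w 1 : ℝ) : ℂ) ^ 4 * ((w 2 : ℝ) : ℂ) ^ 2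
      + 768 * (Real.pi : ℂ) ^ 6 * I ^ 4 * ((w 1 : ℝ) : ℂ) ^ 6 + 3840 * (Real.pi : ℂ) ^ 6 * I ^ 4 * ((w 0 : ℝ) : ℂ) ^ 2 * ((w 2
      : ℝ) : ℂ) ^ 4 + 3840 * (Real.pi : ℂ) ^ 6 * I ^ 4 * ((w 0 : ℝ) : ℂ) ^ 2 * ((w 1 : ℝ) : ℂ) ^ 4 + 3840 * (Real.pi : ℂ) ^ 6
      * I ^ 4 * ((w 0 : ℝ) : ℂ) ^ 4 * ((w 2 : ℝ) : ℂ) ^ 2 + 3840 * (Real.pi : ℂ) ^ 6 * I ^ 4 * ((w 0 : ℝ) : ℂ) ^ 4 * ((w 1 :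
      ℝ) : ℂ) ^ 2 + 768 * (Real.pi : ℂ) ^ 6 * I ^ 4 * ((w 0 : ℝ) : ℂ) ^ 6) * Complex.I_sq
    + (768 * (Real.pi : ℂ) ^ 6 * ((w 2 : ℝ) : ℂ) ^ 4 - 6144 * (Real.pi : ℂ) ^ 6 * ((w 1 : ℝ) : ℂ) ^ 2 * ((w 2 : ℝ) : ℂ) ^ 2 +
      768 * (Real.pi : ℂ) ^ 6 * ((w 1 : ℝ) : ℂ) ^ 4 - 6144 * (Real.pi : ℂ) ^ 6 * ((w 0 : ℝ) : ℂ) ^ 2 * ((w 2 : ℝ) : ℂ) ^ 2 -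
      6144 * (Real.pi : ℂ) ^ 6 * ((w 0 : ℝ) : ℂ) ^ 2 * ((w 1 : ℝ) : ℂ) ^ 2 + 768 * (Real.pi : ℂ) ^ 6 * ((w 0 : ℝ) : ℂ) ^ 4 -
      3072 * (Real.pi : ℂ) ^ 6 * (‖w‖ : ℂ) ^ 2 * ((w 2 : ℝ) : ℂ) ^ 2 - 3072 * (Real.pi : ℂ) ^ 6 * (‖w‖ : ℂ) ^ 2 * ((w 1 : ℝ) :
      ℂ) ^ 2 - 3072 * (Real.pi : ℂ) ^ 6 * (‖w‖ : ℂ) ^ 2 * ((w 0 : ℝ) : ℂ) ^ 2 + 768 * (Real.pi : ℂ) ^ 6 * (‖w‖ : ℂ) ^ 4) * hn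

/-! ## §3 The Laplace–Fourier representation of the witness -/

/-- ★ **Laplace–Fourier representation of `K = 3h₆/‖x‖¹⁴` on the half-space.**  For `y ∈ ℝ⁴` with `y₀ > 0`,
`K(y) = (π⁷/5) ∫_{ℝ³} e^{−2πy₀|w|} |w|⁻¹ e^{−2πi⟪w,y⃗⟫} W(w) dw`, `W(w) = Σ_{j≠k} w_j⁴w_k² + 2w₀²w₁²w₂²`. [folklore] -/
theorem bigOWitness_eq_integral (y : E4) (hy : 0 < y 0) :
    ((bigOWitness y : ℝ) : ℂ) = ((Real.pi ^ 7 / 5 : ℝ) : ℂ) * ∫ (w : EuclideanSpace ℝ (Fin 3)),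
      ((Real.exp (-(2 * Real.pi * y 0 * ‖w‖)) / ‖w‖ : ℝ) : ℂ) *
        cexp (↑(-2 * Real.pi * ⟪w, (WithLp.equiv 2 (Fin 3 → ℝ)).symm (fun j : Fin 3 => y j.succ)⟫) * I) *
        (((w 0 ^ 4 * w 1 ^ 2 + w 0 ^ 4 * w 2 ^ 2 + w 1 ^ 4 * w 0 ^ 2 + w 1 ^ 4 * w 2 ^ 2 + w 2 ^ 4 * w 0 ^ 2 + w 2 ^ 4 * w 1 ^ 2 +
          2 * (w 0 ^ 2 * w 1 ^ 2 * w 2 ^ 2) : ℝ)) : ℂ) := by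
  have hy0 : y ≠ 0 := by
    intro h; rw [h] at hy; simp at hy
  -- part 1, in `T`-form
  have h1 : ∑ t ∈ T, iteratedDeriv 6 (fun s : ℝ => (‖y + s • rv t‖ ^ 2)⁻¹) 0 = -46080 * bigOWitness y := by
    rw [← sum_roots_eq_sum_T (fun v : E4 => iteratedDeriv 6 (fun s : ℝ => (‖y + s • v‖ ^ 2)⁻¹) 0)]
    exact sum_roots_iteratedDeriv_six y hy0
  -- part 2, for each root
  have h2 : ∀ t : Fin 4 × Fin 4 × Bool × Bool,
      ((iteratedDeriv 6 (fun s : ℝ => (‖y + s • rv t‖ ^ 2)⁻¹) 0 : ℝ) : ℂ) =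
        ↑Real.pi * ∫ (w : EuclideanSpace ℝ (Fin 3)),
          ((Real.exp (-(2 * Real.pi * y 0 * ‖w‖)) / ‖w‖ : ℝ) : ℂ) *
            cexp (↑(-2 * Real.pi * ⟪w, (WithLp.equiv 2 (Fin 3 → ℝ)).symm (fun j : Fin 3 => y j.succ)⟫) * I) *
            ((((-(2 * Real.pi * (rv t) 0 * ‖w‖)) : ℝ) : ℂ) +
              (((-(2 * Real.pi * ⟪w, (WithLp.equiv 2 (Fin 3 → ℝ)).symm (fun j : Fin 3 => (rv t) j.succ)⟫)) : ℝ) : ℂ) *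
                I) ^ 6 := by
    intro t
    have hf : (fun s : ℝ => (‖y + s • rv t‖ ^ 2)⁻¹) = fun s : ℝ => ((y 0 + s * (rv t) 0) ^ 2 +
        ‖(WithLp.equiv 2 (Fin 3 → ℝ)).symm (fun j : Fin 3 => y j.succ) +
          s • (WithLp.equiv 2 (Fin 3 → ℝ)).symm (fun j : Fin 3 => (rv t) j.succ)‖ ^ 2)⁻¹ :=
      funext fun s => by rw [norm_add_smul_sq_split]
    rw [hf]
    exact (iteratedDeriv_six_inv_sq_eq_integral _ ((rv t) 0) _ hy).2
  have hint : ∀ t : Fin 4 × Fin 4 × Bool × Bool, Integrable (fun w : EuclideanSpace ℝ (Fin 3) =>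
      ((Real.exp (-(2 * Real.pi * y 0 * ‖w‖)) / ‖w‖ : ℝ) : ℂ) *
        cexp (↑(-2 * Real.pi * ⟪w, (WithLp.equiv 2 (Fin 3 → ℝ)).symm (fun j : Fin 3 => y j.succ)⟫) * I) *
        ((((-(2 * Real.pi * (rv t) 0 * ‖w‖)) : ℝ) : ℂ) +
          (((-(2 * Real.pi * ⟪w, (WithLp.equiv 2 (Fin 3 → ℝ)).symm (fun j : Fin 3 => (rv t) j.succ)⟫)) : ℝ) : ℂ) *
            I) ^ 6) := fun t => (iteratedDeriv_six_inv_sq_eq_integral _ ((rv t) 0) _ hy).1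
  have h3 : (((-46080 * bigOWitness y : ℝ)) : ℂ) = ↑Real.pi * ∫ (w : EuclideanSpace ℝ (Fin 3)),
      ((Real.exp (-(2 * Real.pi * y 0 * ‖w‖)) / ‖w‖ : ℝ) : ℂ) *
        cexp (↑(-2 * Real.pi * ⟪w, (WithLp.equiv 2 (Fin 3 → ℝ)).symm (fun j : Fin 3 => y j.succ)⟫) * I) *
        (((-9216 * Real.pi ^ 6 * (w 0 ^ 4 * w 1 ^ 2 + w 0 ^ 4 * w 2 ^ 2 + w 1 ^ 4 * w 0 ^ 2 + w 1 ^ 4 * w 2 ^ 2 +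
          w 2 ^ 4 * w 0 ^ 2 + w 2 ^ 4 * w 1 ^ 2 + 2 * (w 0 ^ 2 * w 1 ^ 2 * w 2 ^ 2))) : ℝ) : ℂ) := by
    rw [← h1, Complex.ofReal_sum, Finset.sum_congr rfl (fun t _ => h2 t), ← Finset.mul_sum,
      ← integral_finsetSum _ (fun t _ => hint t)]
    congr 1
    refine integral_congr_ae (Eventually.of_forall fun w => ?_)
    dsimp only
    rw [← Finset.mul_sum, sum_T_slope_pow_six w]
  have h4 : (((-46080 * bigOWitness y : ℝ)) : ℂ) = ↑Real.pi * (((-9216 * Real.pi ^ 6 : ℝ) : ℂ) *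
      ∫ (w : EuclideanSpace ℝ (Fin 3)), ((Real.exp (-(2 * Real.pi * y 0 * ‖w‖)) / ‖w‖ : ℝ) : ℂ) *
        cexp (↑(-2 * Real.pi * ⟪w, (WithLp.equiv 2 (Fin 3 → ℝ)).symm (fun j : Fin 3 => y j.succ)⟫) * I) *
        (((w 0 ^ 4 * w 1 ^ 2 + w 0 ^ 4 * w 2 ^ 2 + w 1 ^ 4 * w 0 ^ 2 + w 1 ^ 4 * w 2 ^ 2 + w 2 ^ 4 * w 0 ^ 2 + w 2 ^ 4 * w 1 ^ 2 +
          2 * (w 0 ^ 2 * w 1 ^ 2 * w 2 ^ 2) : ℝ)) : ℂ)) := by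
    rw [h3]
    congr 1
    rw [← integral_const_mul]
    refine integral_congr_ae (Eventually.of_forall fun w => ?_)
    dsimp only
    push_cast
    ring
  push_cast at h4 ⊢
  linear_combination (-1 / 46080 : ℂ) * h4

/-! ## §4 Evenness of the witness, the weight `W`, integrability -/

/-- The coordinates are continuous on `ℝ³`. [folklore] -/
theorem continuous_coordE3 (i : Fin 3) : Continuous fun w : EuclideanSpace ℝ (Fin 3) => w i :=
  (continuous_apply i).comp (PiLp.continuous_ofLp 2 _)

/-- `K(−u) = K(u)` (the sextic and the norm are even). [folklore] -/
theorem bigOWitness_neg (u : E4) : bigOWitness (-u) = bigOWitness u := by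
  rw [bigOWitness, bigOWitness, h6three_expand, h6three_expand, rootSextic_expand, rootSextic_expand, norm_neg]
  simp only [PiLp.neg_apply]
  ring

/-- `K(θxᵢ − xⱼ) = K(xⱼ − θxᵢ)`. [folklore] -/
theorem bigOWitness_timeReflection_sub (a b : E4) :
    bigOWitness (timeReflection 4 a - b) = bigOWitness (b - timeReflection 4 a) := by
  rw [← bigOWitness_neg, neg_sub]

/-- `0 ≤ W(w) ≤ ‖w‖⁶`. [folklore] -/
theorem weight_nonneg_le (w : EuclideanSpace ℝ (Fin 3)) :
    0 ≤ w 0 ^ 4 * w 1 ^ 2 + w 0 ^ 4 * w 2 ^ 2 + w 1 ^ 4 * w 0 ^ 2 + w 1 ^ 4 * w 2 ^ 2 + w 2 ^ 4 * w 0 ^ 2 + w 2 ^ 4 * w 1 ^ 2 +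
        2 * (w 0 ^ 2 * w 1 ^ 2 * w 2 ^ 2) ∧
      w 0 ^ 4 * w 1 ^ 2 + w 0 ^ 4 * w 2 ^ 2 + w 1 ^ 4 * w 0 ^ 2 + w 1 ^ 4 * w 2 ^ 2 + w 2 ^ 4 * w 0 ^ 2 + w 2 ^ 4 * w 1 ^ 2 +
        2 * (w 0 ^ 2 * w 1 ^ 2 * w 2 ^ 2) ≤ ‖w‖ ^ 6 := by
  refine ⟨by positivity, ?_⟩
  rw [show ‖w‖ ^ 6 = (‖w‖ ^ 2) ^ 3 by ring, Literature.Algebra.EuclideanLattices.norm_sq_fin_three]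
  nlinarith [sq_nonneg (w 0), sq_nonneg (w 1), sq_nonneg (w 2), pow_nonneg (sq_nonneg (w 0)) 3,
    pow_nonneg (sq_nonneg (w 1)) 3, pow_nonneg (sq_nonneg (w 2)) 3,
    mul_nonneg (mul_nonneg (sq_nonneg (w 0)) (sq_nonneg (w 1))) (sq_nonneg (w 2)),
    mul_nonneg (pow_nonneg (sq_nonneg (w 0)) 2) (sq_nonneg (w 1)), mul_nonneg (pow_nonneg (sq_nonneg (w 0)) 2) (sq_nonneg (w 2)),
    mul_nonneg (pow_nonneg (sq_nonneg (w 1)) 2) (sq_nonneg (w 0)), mul_nonneg (pow_nonneg (sq_nonneg (w 1)) 2) (sq_nonneg (w 2)),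
    mul_nonneg (pow_nonneg (sq_nonneg (w 2)) 2) (sq_nonneg (w 0)), mul_nonneg (pow_nonneg (sq_nonneg (w 2)) 2) (sq_nonneg (w 1))]

/-- Integrability of the representing integrand `e^{−2πτ|w|}|w|⁻¹e^{−2πi⟪w,z⟫} W(w)` for `τ > 0`
(dominated by `|w|⁵e^{−2πτ|w|}`). [folklore] -/
theorem integrable_yukawaPhase_mul_weight {τ : ℝ} (hτ : 0 < τ) (z : EuclideanSpace ℝ (Fin 3)) :
    Integrable fun w : EuclideanSpace ℝ (Fin 3) =>
      ((Real.exp (-(2 * Real.pi * τ * ‖w‖)) / ‖w‖ : ℝ) : ℂ) * cexp (↑(-2 * Real.pi * ⟪w, z⟫) * I) *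
        (((w 0 ^ 4 * w 1 ^ 2 + w 0 ^ 4 * w 2 ^ 2 + w 1 ^ 4 * w 0 ^ 2 + w 1 ^ 4 * w 2 ^ 2 + w 2 ^ 4 * w 0 ^ 2 + w 2 ^ 4 * w 1 ^ 2 +
          2 * (w 0 ^ 2 * w 1 ^ 2 * w 2 ^ 2) : ℝ)) : ℂ) := by
  have hc : 0 < 2 * Real.pi * τ := by positivity
  refine Integrable.mono' (integrable_norm_pow_mul_exp_neg_mul_norm 5 hc) ?_ ?_
  · refine (AEStronglyMeasurable.mul ?_ ?_).mul ?_
    · exact (Complex.measurable_ofReal.comp ((Real.measurable_exp.comp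
        ((measurable_const.mul measurable_norm).neg)).div measurable_norm)).aestronglyMeasurable
    · exact (Complex.continuous_exp.comp ((Complex.continuous_ofReal.comp
        (continuous_const.mul (continuous_id.inner continuous_const))).mul continuous_const)).aestronglyMeasurable
    · have h0 := continuous_coordE3 0
      have h1 := continuous_coordE3 1
      have h2 := continuous_coordE3 2
      exact (Complex.continuous_ofReal.comp (by fun_prop)).aestronglyMeasurable
  · filter_upwards [ae_ne_zero_E3] with w hw
    have hn : 0 < ‖w‖ := norm_pos_iff.2 hw
    obtain ⟨hW0, hW⟩ := weight_nonneg_le w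
    rw [norm_mul, norm_yukawaPhase, Complex.norm_real, Real.norm_of_nonneg hW0, div_mul_eq_mul_div, div_le_iff₀ hn]
    calc Real.exp (-(2 * Real.pi * τ * ‖w‖)) * (w 0 ^ 4 * w 1 ^ 2 + w 0 ^ 4 * w 2 ^ 2 + w 1 ^ 4 * w 0 ^ 2 + w 1 ^ 4 * w 2 ^ 2 +
          w 2 ^ 4 * w 0 ^ 2 + w 2 ^ 4 * w 1 ^ 2 + 2 * (w 0 ^ 2 * w 1 ^ 2 * w 2 ^ 2))
        ≤ Real.exp (-(2 * Real.pi * τ * ‖w‖)) * ‖w‖ ^ 6 := mul_le_mul_of_nonneg_left hW (Real.exp_pos _).le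
      _ = ‖w‖ ^ 5 * Real.exp (-(2 * Real.pi * τ * ‖w‖)) * ‖w‖ := by ring

/-! ## §5 Reflection positivity of the witness -/

/-- The spatial part of `b − θa` is `b⃗ − a⃗`. [folklore] -/
theorem spacePart_sub_timeReflection (a b : E4) :
    ((WithLp.equiv 2 (Fin 3 → ℝ)).symm (fun k : Fin 3 => (b - timeReflection 4 a) k.succ)) = ((WithLp.equiv 2 (Fin 3 → ℝ)).symm (fun k : Fin 3 => b k.succ)) - ((WithLp.equiv 2 (Fin 3 → ℝ)).symm (fun k : Fin 3 => a k.succ)) := by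
  ext k
  simp [timeReflection_apply, Fin.succ_ne_zero]

/-- The time component of `b − θa` is `b₀ + a₀`. [folklore] -/
theorem sub_timeReflection_apply_zero (a b : E4) : (b - timeReflection 4 a) 0 = b 0 + a 0 := by
  simp [timeReflection_apply]

/-- **Splitting of the pair integrand**: `cₐc_b · e^{−2π(b₀+a₀)|w|}|w|⁻¹e^{−2πi⟪w,b⃗−a⃗⟫} W = (W/|w|) · ū_a u_b` with
`u_x = c_x e^{−2πx₀|w|} e^{−2πi⟪w,x⃗⟫}`. [folklore] -/
theorem pair_integrand_eq (a b : E4) (ca cb : ℝ) (w : EuclideanSpace ℝ (Fin 3)) :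
    (ca : ℂ) * (cb : ℂ) * (((Real.exp (-(2 * Real.pi * (b - timeReflection 4 a) 0 * ‖w‖)) / ‖w‖ : ℝ) : ℂ) * cexp (↑(-2 * Real.pi * ⟪w, ((WithLp.equiv 2 (Fin 3 → ℝ)).symm (fun k : Fin 3 => (b - timeReflection 4 a) k.succ))⟫) * I) * (((w 0 ^ 4 * w 1 ^ 2 + w 0 ^ 4 * w 2 ^ 2 + w 1 ^ 4 * w 0 ^ 2 + w 1 ^ 4 * w 2 ^ 2 + w 2 ^ 4 * w 0 ^ 2 + w 2 ^ 4 * w 1 ^ 2 +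
          2 * (w 0 ^ 2 * w 1 ^ 2 * w 2 ^ 2)) : ℝ) : ℂ)) =
      (((w 0 ^ 4 * w 1 ^ 2 + w 0 ^ 4 * w 2 ^ 2 + w 1 ^ 4 * w 0 ^ 2 + w 1 ^ 4 * w 2 ^ 2 + w 2 ^ 4 * w 0 ^ 2 + w 2 ^ 4 * w 1 ^ 2 +
          2 * (w 0 ^ 2 * w 1 ^ 2 * w 2 ^ 2)) / ‖w‖ : ℝ) : ℂ) * ((((ca * Real.exp (-(2 * Real.pi * a 0 * ‖w‖)) : ℝ) : ℂ) * cexp (-(↑(-2 * Real.pi * ⟪w, ((WithLp.equiv 2 (Fin 3 → ℝ)).symm (fun k : Fin 3 => a k.succ))⟫) * I))) * (((cb * Real.exp (-(2 * Real.pi * b 0 * ‖w‖)) : ℝ) : ℂ) * cexp (↑(-2 * Real.pi * ⟪w, ((WithLp.equiv 2 (Fin 3 → ℝ)).symm (fun k : Fin 3 => b k.succ))⟫) * I))) := by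
  rw [sub_timeReflection_apply_zero, spacePart_sub_timeReflection, inner_sub_right,
    show -(2 * Real.pi * (b 0 + a 0) * ‖w‖) = -(2 * Real.pi * a 0 * ‖w‖) + -(2 * Real.pi * b 0 * ‖w‖) by ring, Real.exp_add,
    show (↑(-2 * Real.pi * (⟪w, ((WithLp.equiv 2 (Fin 3 → ℝ)).symm (fun k : Fin 3 => b k.succ))⟫ - ⟪w, ((WithLp.equiv 2 (Fin 3 → ℝ)).symm (fun k : Fin 3 => a k.succ))⟫)) * I : ℂ) =
      -(↑(-2 * Real.pi * ⟪w, ((WithLp.equiv 2 (Fin 3 → ℝ)).symm (fun k : Fin 3 => a k.succ))⟫) * I) + (↑(-2 * Real.pi * ⟪w, ((WithLp.equiv 2 (Fin 3 → ℝ)).symm (fun k : Fin 3 => b k.succ))⟫) * I) by push_cast; ring,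
    Complex.exp_add]
  push_cast
  ring

/-- Conjugating `u_x` flips the sign of the phase. [folklore] -/
theorem conj_phase (r θ : ℝ) : conj (((r : ℝ) : ℂ) * cexp (↑θ * I)) = ((r : ℝ) : ℂ) * cexp (-(↑θ * I)) := by
  rw [map_mul, Complex.conj_ofReal, ← Complex.exp_conj, map_mul, Complex.conj_ofReal, Complex.conj_I, mul_neg]

/-- ★★ **`WitnessReflectionPositive`**: the witness `K = 3h₆/‖x‖¹⁴` is reflection positive across `x₀ = 0`:
`Σᵢⱼ cᵢcⱼ K(θxᵢ − xⱼ) = (π⁷/5) ∫ |w|⁻¹ W(w) |Σⱼ cⱼ e^{−2πtⱼ|w|}e^{−2πi⟪w,z⃗ⱼ⟫}|² dw ≥ 0`. -/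
theorem witnessReflectionPositive : WitnessReflectionPositive := by
  intro m x c hx
  -- Step 1: every kernel value is an integral
  have hpos : ∀ i j : Fin m, 0 < (x j - timeReflection 4 (x i)) 0 := fun i j => by
    rw [sub_timeReflection_apply_zero]; exact add_pos (hx j) (hx i)
  have hK : ∀ i j : Fin m, ((c i * c j * bigOWitness (timeReflection 4 (x i) - x j) : ℝ) : ℂ) =
      ((Real.pi ^ 7 / 5 : ℝ) : ℂ) * ∫ (w : EuclideanSpace ℝ (Fin 3)), (c i : ℂ) * (c j : ℂ) * (((Real.exp (-(2 * Real.pi * ((x j) - timeReflection 4 (x i)) 0 * ‖w‖)) / ‖w‖ : ℝ) : ℂ) * cexp (↑(-2 * Real.pi * ⟪w, ((WithLp.equiv 2 (Fin 3 → ℝ)).symm (fun k : Fin 3 => ((x j) - timeReflection 4 (x i)) k.succ))⟫) * I) * (((w 0 ^ 4 * w 1 ^ 2 + w 0 ^ 4 * w 2 ^ 2 + w 1 ^ 4 * w 0 ^ 2 + w 1 ^ 4 * w 2 ^ 2 + w 2 ^ 4 * w 0 ^ 2 + w 2 ^ 4 * w 1 ^ 2 +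
          2 * (w 0 ^ 2 * w 1 ^ 2 * w 2 ^ 2)) : ℝ) : ℂ)) := by
    intro i j
    rw [bigOWitness_timeReflection_sub, Complex.ofReal_mul, Complex.ofReal_mul, bigOWitness_eq_integral _ (hpos i j),
      ← integral_const_mul, ← integral_const_mul, ← integral_const_mul]
    refine integral_congr_ae (Eventually.of_forall fun w => ?_)
    dsimp only
    ring
  -- integrability of the pair integrands
  have hI : ∀ i j : Fin m, Integrable (fun w : EuclideanSpace ℝ (Fin 3) => (c i : ℂ) * (c j : ℂ) * (((Real.exp (-(2 * Real.pi * ((x j) - timeReflection 4 (x i)) 0 * ‖w‖)) / ‖w‖ : ℝ) : ℂ) * cexp (↑(-2 * Real.pi * ⟪w, ((WithLp.equiv 2 (Fin 3 → ℝ)).symm (fun k : Fin 3 => ((x j) - timeReflection 4 (x i)) k.succ))⟫) * I) * (((w 0 ^ 4 * w 1 ^ 2 + w 0 ^ 4 * w 2 ^ 2 + w 1 ^ 4 * w 0 ^ 2 + w 1 ^ 4 * w 2 ^ 2 + w 2 ^ 4 * w 0 ^ 2 + w 2 ^ 4 * w 1 ^ 2 +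
          2 * (w 0 ^ 2 * w 1 ^ 2 * w 2 ^ 2)) : ℝ) : ℂ))) := fun i j =>
    (integrable_yukawaPhase_mul_weight (hpos i j) _).const_mul _
  -- Step 2: the quadratic form as ONE integral of `(W/|w|)·|U(w)|²`
  have hsum : (((∑ i, ∑ j, c i * c j * bigOWitness (timeReflection 4 (x i) - x j) : ℝ)) : ℂ) =
      ((Real.pi ^ 7 / 5 : ℝ) : ℂ) * ∫ (w : EuclideanSpace ℝ (Fin 3)),
        (((w 0 ^ 4 * w 1 ^ 2 + w 0 ^ 4 * w 2 ^ 2 + w 1 ^ 4 * w 0 ^ 2 + w 1 ^ 4 * w 2 ^ 2 + w 2 ^ 4 * w 0 ^ 2 + w 2 ^ 4 * w 1 ^ 2 +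
          2 * (w 0 ^ 2 * w 1 ^ 2 * w 2 ^ 2)) / ‖w‖ * Complex.normSq (∑ j, (((c j * Real.exp (-(2 * Real.pi * (x j) 0 * ‖w‖)) : ℝ) : ℂ) * cexp (↑(-2 * Real.pi * ⟪w, ((WithLp.equiv 2 (Fin 3 → ℝ)).symm (fun k : Fin 3 => (x j) k.succ))⟫) * I))) : ℝ) : ℂ) := by
    rw [Complex.ofReal_sum]
    simp_rw [Complex.ofReal_sum, hK]
    simp_rw [← Finset.mul_sum]
    congr 1
    have inner : ∀ i : Fin m, (∑ j, ∫ (w : EuclideanSpace ℝ (Fin 3)), (c i : ℂ) * (c j : ℂ) * (((Real.exp (-(2 * Real.pi * ((x j) - timeReflection 4 (x i)) 0 * ‖w‖)) / ‖w‖ : ℝ) : ℂ) * cexp (↑(-2 * Real.pi * ⟪w, ((WithLp.equiv 2 (Fin 3 → ℝ)).symm (fun k : Fin 3 => ((x j) - timeReflection 4 (x i)) k.succ))⟫) * I) * (((w 0 ^ 4 * w 1 ^ 2 + w 0 ^ 4 * w 2 ^ 2 + w 1 ^ 4 * w 0 ^ 2 + w 1 ^ 4 * w 2 ^ 2 + w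 2 ^ 4 * w 0 ^ 2 + w 2 ^ 4 * w 1 ^ 2 +
          2 * (w 0 ^ 2 * w 1 ^ 2 * w 2 ^ 2)) : ℝ) : ℂ))) =
        ∫ (w : EuclideanSpace ℝ (Fin 3)), ∑ j, (c i : ℂ) * (c j : ℂ) * (((Real.exp (-(2 * Real.pi * ((x j) - timeReflection 4 (x i)) 0 * ‖w‖)) / ‖w‖ : ℝ) : ℂ) * cexp (↑(-2 * Real.pi * ⟪w, ((WithLp.equiv 2 (Fin 3 → ℝ)).symm (fun k : Fin 3 => ((x j) - timeReflection 4 (x i)) k.succ))⟫) * I) * (((w 0 ^ 4 * w 1 ^ 2 + w 0 ^ 4 * w 2 ^ 2 + w 1 ^ 4 * w 0 ^ 2 + w 1 ^ 4 * w 2 ^ 2 + w 2 ^ 4 * w 0 ^ 2 + w 2 ^ 4 * w 1 ^ 2 +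
          2 * (w 0 ^ 2 * w 1 ^ 2 * w 2 ^ 2)) : ℝ) : ℂ)) :=
      fun i => (integral_finsetSum _ (fun j _ => hI i j)).symm
    rw [Finset.sum_congr rfl (fun i _ => inner i),
      ← integral_finsetSum _ (fun i _ => integrable_finsetSum _ (fun j _ => hI i j))]
    refine integral_congr_ae (Eventually.of_forall fun w => ?_)
    dsimp only
    simp_rw [pair_integrand_eq]
    simp_rw [← Finset.mul_sum]
    rw [← Finset.sum_mul]
    have hconj : (∑ i, (((c i * Real.exp (-(2 * Real.pi * (x i) 0 * ‖w‖)) : ℝ) : ℂ) * cexp (-(↑(-2 * Real.pi * ⟪w, ((WithLp.equiv 2 (Fin 3 → ℝ)).symm (fun k : Fin 3 => (x i) k.succ))⟫) * I)))) = conj (∑ i, (((c i * Real.exp (-(2 * Real.pi * (x i) 0 * ‖w‖)) : ℝ) : ℂ) * cexp (↑(-2 * Real.pi * ⟪w, ((WithLp.equiv 2 (Fin 3 → ℝ)).symm (fun k : Fin 3 => (x i) k.succ))⟫) * I))) := by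
      rw [map_sum]
      exact Finset.sum_congr rfl fun i _ => (conj_phase _ _).symm
    rw [hconj, ← Complex.normSq_eq_conj_mul_self]
    push_cast
    ring
  -- Step 3: a nonnegative real integral
  rw [integral_complex_ofReal, ← Complex.ofReal_mul] at hsum
  rw [Complex.ofReal_injective hsum]
  refine mul_nonneg (by positivity) (integral_nonneg fun w => ?_)
  exact mul_nonneg (div_nonneg (weight_nonneg_le w).1 (norm_nonneg _)) (Complex.normSq_nonneg _)

/-! ## §6 The negative target, assembled -/

/-- ★★★ **NEGATIVE TARGET `NotShortRootRigidityBigO`**: C3 «global short-root rigidity» with the BIG-O budget `‖x‖⁸|K| ≤ C` in place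
of the little-o budget is FALSE — the witness `K = 3h₆/‖x‖¹⁴` satisfies all six hypotheses (w3 g37: continuity, boundedness,
`W(B₄)`- and `D₄`-invariance, big-O; this file: reflection positivity) and is not `O(4)`-invariant.  So any proof of ⟨23035⟩
`ShortRootRigidity` must use the little-o budget at exponent 8. -/
theorem not_shortRootRigidityBigO : NotShortRootRigidityBigO := by
  intro hrig
  obtain ⟨R, x, hne⟩ := witnessNotRadial
  exact hne (hrig bigOWitness witnessContinuousOffZero witnessBoundedOutsideBall witnessSignedPermInvariant
    witnessReflectionPositive witnessBigO witnessLatticeInvariant R x)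

end Summit.QuantumFields.YangMills.Cruxes.ShortRootRigidity.Sharpness

end
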